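import Literature.AlgebraicGeometry.Motives.HodgeLieWeilClassesProductCorner
import Summits.HodgeConjecture.CorCM.MumfordTateRankQuadraticFieldAction
import Summits.HodgeConjecture.CorCM.MumfordTateRankCMCurvePowers
import Summits.HodgeConjecture.CorCM.MumfordTateRankDuplicateFactor
import HarnessLib

/-!
# Ribet type `(g − 1, 1)` × a CM elliptic curve with the SAME imaginary quadratic field: `dim MT(H¹(A × E)) = g² + 1` for every `g ≥ 3`
# (Moonen–Zarhin's mechanism (4)(a) in all dimensions: the Weil classes of `A × E^{g−2}` with the conjugate-matched diagonal `k`-action)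

COR-CM (cell `pub-hodgecm2`, seat `b27` gen 48, count-neutral Mumford–Tate-rank ladder; theorems only, no definition, no named fact;
UNCONDITIONAL — nothing here uses or asserts HC_CM).  `A` of RIBET TYPE `(g − 1, 1)`: `End⁰A = k = ℚ(√−D)` an imaginary quadratic field
(`dim_ℚ End⁰A = 2`, `φ ∘ φ = −D`), multiplicity one at `i√D` or `−i√D` on `H^{1,0}(A)`, `g = dim A ≥ 3` — so `Lie Hg(H¹A) = 𝔲_k` has dimension
`g²` and `t(A) = g² + 1` (`CorCM/MumfordTateRankRibetTypeOne`, Ribet 1983).  `E` an elliptic curve with `χ ∘ χ = −D` (complex multiplication by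
the SAME field).  For DIFFERENT fields `t(A × E) = g² + 2 = t(A) + t(E) − 1` (`CorCM/MumfordTateRankTimesCMCurve`); here:
**`t(A × E) = g² + 1`**, i.e. `Hg(A × E) ⊊ Hg(A) × Hg(E)` has codimension one, for EVERY `g ≥ 3` (Moonen–Zarhin treat `g = 3`).

MECHANISM.  Match the roots so that `n_{i√D}(A) + (g − 2)·n_{i√D}(E) = g − 1` (replace `χ` by `−χ` otherwise).  Then the diagonal action of `k`
on `H¹(A × E^{g−2})` — on `E^{g−2} = E.powSucc (g−3)` through the componentwise `χ^{g−2}` — has multiplicities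
`(g − 1) + 0·(g−2) = g − 1 = 1 + 1·(g − 2)`: it is OF WEIL TYPE (`dim = 2g + 2(g−2) = 2(2g − 2)`).  By `Motives/HodgeLieWeilClassesProductCorner`
(summand of any rank) the corner `0 ⊕ (χ^{g−2})^*` — which lies in `Lie Hg(H¹(E^{g−2}))` (`CorCM/MumfordTateRankCMCurvePowers`) — is NOT in
`Lie Hg(H¹(A × E^{g−2}))`, so `dim Lie Hg(H¹(A × E^{g−2})) < g² + 1`; rigidity of `A` (`CorCM/MumfordTateRankRigidMonotone`) gives `≥ g²`; hence
`= g²` and `t(A × E^{g−2}) = g² + 1`; finally `t(A × E) = t(A × E^{g−2})` (`CorCM/MumfordTateRankDuplicateFactor`).  For `g = 3` this is the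
fourfold cell of `CorCM/MumfordTateRankTimesCMCurveSameField`.

* §1 **`finrank_hodgeLie_hodge_one_ribetTypeOne_prod_cmCurvePow_sameField`** (`dim Lie Hg(H¹(A × E^{g−2})) = g²`, matched roots).
* §2 **`mtRank_hodge_one_eq_of_isIsogenous_ribetTypeOne_prod_cmCurve_sameField`** (`t(X) = g² + 1` for `X ∼ E × A`, matched roots) and the
  root-free form **`mtRank_hodge_one_eq_of_isIsogenous_ribetTypeOne_prod_cmCurve_of_exists_comp_self_eq_neg`** (hypothesis: SOME `χ` on `E` with
  `χ ∘ χ = −D`, the same `D` as `φ`; the sign is fixed inside).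

## References
* [MoonenZarhin1999LowDim] B. Moonen, Yu. G. Zarhin, Math. Ann. 315 (1999), Thm. 0.1 (4)(a), (1.9), §3 (3.1), Prop. (3.8)
  [corpus: paper:arxiv-math_9901113 pp. 1–3, 6–7]. [cite: MoonenZarhin1999LowDim, Thm. 0.1 (4) and §3 (3.1)]
* [Ribet1983] K. A. Ribet, Amer. J. Math. 105 (1983), Thm. 3. [cite: Ribet1983, Thm. 3]
* [Deligne1982HodgeCycles] P. Deligne, LNM 900 (1982), §4 Prop. 4.4 (Weil classes). [cite: Deligne1982HodgeCycles, §4 Prop. 4.4]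
* [LangeBirkenhake1992] H. Lange, Ch. Birkenhake, *Complex Abelian Varieties* (1992), §1.1. [cite: LangeBirkenhake1992, §1.1 (p. 19)]
-/

noncomputable section

open scoped TensorProduct
open CategoryTheory CategoryTheory.Limits Module NumberField

namespace Summit.HodgeConjecture.CorCM

open Literature.AlgebraicGeometry.Motives
open Literature.AlgebraicGeometry.Motives.AbelianVariety
open Literature.AlgebraicGeometry.Motives.HodgeStructure
open Literature.AlgebraicGeometry.HodgeTheory
open Literature.AlgebraicGeometry.ComplexMultiplication
open Literature.AlgebraicGeometry.Milne1999 (IsOfCMType)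
open Literature.AlgebraicGeometry.Pohlmann1968 (isIsogenous_powSucc_biproduct)

variable [HodgeTensorFacts.{0, 0}] {X A E : AbelianVariety ℂ} {n : ℕ}

omit [HodgeTensorFacts.{0, 0}] in
/-- The multiplicity flips under `χ ↦ −χ` (`(−χ)^* = −χ^*`, `complexBetti_map_neg_one`). [cite: LangeBirkenhake1992, §1.1 (p. 19)] -/
private theorem eigenMultiplicity_neg₃ (χ : E ⟶ E) (μ : ℂ) : eigenMultiplicity E (-χ) μ = eigenMultiplicity E χ (-μ) := by
  have hE : Module.End.eigenspace (complexBetti.map (-χ).hom.hom.hom 1).hom μ =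
      Module.End.eigenspace (complexBetti.map χ.hom.hom.hom 1).hom (-μ) := by
    rw [complexBetti_map_neg_one]
    ext x
    rw [Module.End.mem_eigenspace_iff, Module.End.mem_eigenspace_iff, ModuleCat.hom_neg, LinearMap.neg_apply, neg_smul]
    exact neg_eq_iff_eq_neg
  unfold eigenMultiplicity
  rw [hE]

omit [HodgeTensorFacts.{0, 0}] in
/-- `dim E^{m+1} = (m+1) dim E`. [folklore] -/
private theorem dim_powSucc' (E : AbelianVariety ℂ) (m : ℕ) : (E.powSucc m).dim = (m + 1) * E.dim := by
  rw [dim_eq_of_isIsogeny (isIsogenous_powSucc_biproduct E m).choose_spec, AndreRiemann.dim_biproduct_const]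

/-! ## §1 `dim Lie Hg(H¹(A × E^{g−2})) = g²` -/

/-- **`dim Lie Hg(H¹(A × E^{g−2})) = g²` for `A` of Ribet type `(g−1,1)` and a CM elliptic curve `E` with the same field, roots matched**:
`φ ∘ φ = −D` on `A` (`dim_ℚ End⁰A = 2`, a non-totally-real field; multiplicity one at `± i√D`; `dim A = m + 3 = g`), `χ ∘ χ = −D` on `E`,
`n_{i√D}(A) + (m+1)·n_{i√D}(E) = m + 2`; `E^{g−2} = E.powSucc m`.  The diagonal `k`-action on `H¹(A × E^{g−2})` is of Weil type, the corner
`0 ⊕ (χ^{g−2})^*` is not in `Lie Hg` (`corner_not_mem_and_finrank_hodgeLie_lt_of_weilType_of_two_le`): `< g² + 1`; rigidity of `A`: `≥ g²`.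
[cite: MoonenZarhin1999LowDim, Thm. 0.1 (4) and §3 (3.1)] [cite: Ribet1983, Thm. 3] [cite: Deligne1982HodgeCycles, §4 Prop. 4.4] -/
theorem finrank_hodgeLie_hodge_one_ribetTypeOne_prod_cmCurvePow_sameField {m k : ℕ} (hP : IsSmoothProjective k (A.prod (E.powSucc m)).X)
    (hF : IsField A.endAlgebra) (hnR : ¬ IsTotallyReal (EndField A hF)) (φ : A ⟶ A) {D : ℕ} (hD : 0 < D) (hφ : φ ≫ φ = -(D • 𝟙 A))
    (hA2 : Module.finrank ℚ A.endAlgebra = 2)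
    (h1 : eigenMultiplicity A φ (Complex.I * (Real.sqrt D : ℂ)) = 1 ∨ eigenMultiplicity A φ (-(Complex.I * (Real.sqrt D : ℂ))) = 1)
    (hdim : A.dim = m + 3) (hE1 : E.dim = 1) (χ : E ⟶ E) (hχ : χ ≫ χ = -(D • 𝟙 E))
    (hmult : eigenMultiplicity A φ (Complex.I * (Real.sqrt D : ℂ)) + (m + 1) * eigenMultiplicity E χ (Complex.I * (Real.sqrt D : ℂ)) = m + 2) :
    haveI := BettiUniverse.finite hP 1
    Module.finrank ℚ (BettiUniverse.hodge exists_isReal_hodgeModel_holds hP 1).hodgeLie = A.dim * A.dim := by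
  classical
  have hnP : (A.prod (E.powSucc m)).dim = k := schemeDim_eq_holds hP
  subst hnP
  have hA : IsSmoothProjective A.dim A.X := AbelianVariety.isSmoothProjective_holds
  have hB : IsSmoothProjective (E.powSucc m).dim (E.powSucc m).X := AbelianVariety.isSmoothProjective_holds
  have hE : IsSmoothProjective E.dim E.X := AbelianVariety.isSmoothProjective_holds
  haveI := BettiUniverse.finite hP 1
  haveI := BettiUniverse.finite hA 1
  haveI := BettiUniverse.finite hB 1
  haveI := BettiUniverse.finite hE 1
  have hBdim : (E.powSucc m).dim = m + 1 := by rw [dim_powSucc', hE1, mul_one]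
  -- `≥ g²`: `A` is rigid with `dim Lie Hg(H¹A) = g²`
  have hgg : Module.finrank ℚ (BettiUniverse.hodge exists_isReal_hodgeModel_holds hA 1).hodgeLie = A.dim * A.dim :=
    (mtRank_hodge_one_of_ribetTypeOne' hA hF hnR φ hD hφ hA2 h1 (by omega)).2
  have hge := finrank_hodgeLie_hodge_one_le_prod_of_rigid (X₂ := E.powSucc m) hA hP
    (hodgeLie_rigid_of_ribetTypeOne hA φ hD hφ hA2 h1 (by omega))
  -- `E` is a CM curve: `End⁰E` a quadratic field `K ∋ c = χ`
  obtain ⟨hEcm, h2E⟩ := isOfCMType_and_mtRank_eq_two_of_curve_of_comp_self_eq_neg hE hE1 χ hD hχ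
  have hE2 : Module.finrank ℚ E.endAlgebra = 2 := finrank_endAlgebra_eq_two_of_cmCurve hE1 hEcm
  have hFE : IsField E.endAlgebra := AbelianVariety.isField_endAlgebra_of_isSimple_of_finrank_eq_two (isSimple_of_dim_le_one hE1.le)
    (by omega) hE2
  haveI : Module.Finite ℚ (EndField E hFE) := NumberField.to_finiteDimensional
  have hK2 : Module.finrank ℚ (EndField E hFE) = 2 := by rw [EndField.finrank_eq, hE2]
  let c : EndField E hFE := (EndField.toEndAlgebra hFE).symm (AbelianVariety.endAlgebra.of E χ)
  have hcK : c * c = -((D : ℚ) • (1 : EndField E hFE)) := by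
    apply (EndField.toEndAlgebra hFE).injective
    rw [map_mul, (EndField.toEndAlgebra hFE).apply_symm_apply, endAlgebra_of_mul_self_eq_neg hχ, map_neg, Nat.cast_smul_eq_nsmul,
      Nat.cast_smul_eq_nsmul, map_nsmul, map_one]
  have hc0 : c ≠ 0 := by
    intro h
    rw [h, mul_zero, eq_comm, neg_eq_zero, smul_eq_zero] at hcK
    rcases hcK with h' | h'
    · exact hD.ne' (by exact_mod_cast h')
    · exact one_ne_zero h'
  -- `K → End⁰A`, `c ↦ φ`, and `K → End⁰(E^{g−2})`, `c ↦ χ^{g−2}`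
  obtain ⟨ρA, hρAc⟩ := exists_ringHom_apply_eq_of_sq_eq_neg hK2 (Nat.cast_pos.2 hD) hcK (R := A.endAlgebra)
    (b := AbelianVariety.endAlgebra.of A φ) (endAlgebra_of_mul_self_eq_neg hφ)
  have hδ := powSuccMap_comp_self_eq_neg χ hχ m
  obtain ⟨ρB, hρBc⟩ := exists_ringHom_apply_eq_of_sq_eq_neg hK2 (Nat.cast_pos.2 hD) hcK (R := (E.powSucc m).endAlgebra)
    (b := AbelianVariety.endAlgebra.of (E.powSucc m) (powSuccMap χ m)) (endAlgebra_of_mul_self_eq_neg hδ)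
  let A₁ : EndAction (BettiUniverse.hodge exists_isReal_hodgeModel_holds hA 1) (EndField E hFE) :=
    hOneEndAction ρA exists_isReal_hodgeModel_holds hodgePQ_independent_of_hodgeModel_holds
  let A₂ : EndAction (BettiUniverse.hodge exists_isReal_hodgeModel_holds hB 1) (EndField E hFE) :=
    hOneEndAction ρB exists_isReal_hodgeModel_holds hodgePQ_independent_of_hodgeModel_holds
  -- the bicone of `H¹(A × E^{g−2})`
  let ι₁ := BettiUniverse.pullHodgeHom exists_isReal_hodgeModel_holds hodgePQ_independent_of_hodgeModel_holds hP hA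
    (fst A (E.powSucc m)).hom.hom.hom 1
  let π₁ := BettiUniverse.pullHodgeHom exists_isReal_hodgeModel_holds hodgePQ_independent_of_hodgeModel_holds hA hP
    (prodLift (𝟙 A) (0 : A ⟶ E.powSucc m)).hom.hom.hom 1
  let ι₂ := BettiUniverse.pullHodgeHom exists_isReal_hodgeModel_holds hodgePQ_independent_of_hodgeModel_holds hP hB
    (snd A (E.powSucc m)).hom.hom.hom 1
  let π₂ := BettiUniverse.pullHodgeHom exists_isReal_hodgeModel_holds hodgePQ_independent_of_hodgeModel_holds hB hP
    (prodLift (0 : E.powSucc m ⟶ A) (𝟙 (E.powSucc m))).hom.hom.hom 1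
  have hsumP : fst A (E.powSucc m) ≫ prodLift (𝟙 A) (0 : A ⟶ E.powSucc m) +
      snd A (E.powSucc m) ≫ prodLift (0 : E.powSucc m ⟶ A) (𝟙 (E.powSucc m)) = 𝟙 _ := by
    refine prod_hom_ext ?_ ?_
    · rw [Preadditive.add_comp, Category.assoc, Category.assoc, prodLift_fst, prodLift_fst, Category.comp_id,
        comp_zero, add_zero, Category.id_comp]
    · rw [Preadditive.add_comp, Category.assoc, Category.assoc, prodLift_snd, prodLift_snd, Category.comp_id,
        comp_zero, zero_add, Category.id_comp]
  have hπι₁ : ∀ v, π₁.toLinearMap (ι₁.toLinearMap v) = v := fun v => pull_pull_eq_self_of_comp_eq_id (prodLift_fst _ _) v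
  have hπι₂ : ∀ v, π₂.toLinearMap (ι₂.toLinearMap v) = v := fun v => pull_pull_eq_self_of_comp_eq_id (prodLift_snd _ _) v
  have hsum : ∀ v, ι₁.toLinearMap (π₁.toLinearMap v) + ι₂.toLinearMap (π₂.toLinearMap v) = v := fun v =>
    pull_pull_add_pull_pull_eq_self _ _ _ _ hsumP v
  have h12 : ∀ v, π₁.toLinearMap (ι₂.toLinearMap v) = 0 := fun v => by
    have h := congrArg π₁.toLinearMap (hsum (ι₂.toLinearMap v))
    rw [map_add, hπι₂ v, hπι₁] at h
    exact add_eq_left.1 h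
  have h21 : ∀ v, π₂.toLinearMap (ι₁.toLinearMap v) = 0 := fun v => by
    have h := congrArg π₂.toLinearMap (hsum (ι₁.toLinearMap v))
    rw [map_add, hπι₁ v, hπι₂] at h
    exact add_eq_left.1 h
  -- the diagonal action on `H¹(A × E^{g−2})`
  let L : EndField E hFE →ₗ[ℚ] Module.End ℚ (bettiCohomology (A.prod (E.powSucc m)).X 1) :=
    { toFun := fun a => ι₁.toLinearMap ∘ₗ A₁.ι a ∘ₗ π₁.toLinearMap + ι₂.toLinearMap ∘ₗ A₂.ι a ∘ₗ π₂.toLinearMap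
      map_add' := fun a b => by
        rw [map_add, map_add, LinearMap.add_comp, LinearMap.comp_add, LinearMap.add_comp, LinearMap.comp_add]; abel
      map_smul' := fun q a => by
        rw [map_smul, map_smul, LinearMap.smul_comp, LinearMap.comp_smul, LinearMap.smul_comp, LinearMap.comp_smul, RingHom.id_apply,
          smul_add] }
  have hL : ∀ a, L a = ι₁.toLinearMap ∘ₗ A₁.ι a ∘ₗ π₁.toLinearMap + ι₂.toLinearMap ∘ₗ A₂.ι a ∘ₗ π₂.toLinearMap := fun a => rfl
  have hL1 : L 1 = 1 := by
    rw [hL, map_one, map_one]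
    refine LinearMap.ext fun v => ?_
    rw [LinearMap.add_apply, LinearMap.comp_apply, LinearMap.comp_apply, LinearMap.comp_apply, LinearMap.comp_apply,
      Module.End.one_apply, Module.End.one_apply, Module.End.one_apply, hsum]
  have hLmul : ∀ a b, L (a * b) = L a * L b := by
    intro a b
    rw [hL, hL, hL, map_mul, map_mul]
    refine LinearMap.ext fun v => ?_
    simp only [LinearMap.add_apply, LinearMap.comp_apply, Module.End.mul_apply, map_add, hπι₁, hπι₂, h12, h21, map_zero,
      add_zero, zero_add]
  have hLmem : ∀ a, L a ∈ (BettiUniverse.hodge exists_isReal_hodgeModel_holds hP 1).endAlg := fun a =>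
    Subalgebra.add_mem _ (((ι₁.comp (endAlg.toHom ⟨A₁.ι a, fun p => A₁.map_F_le a p⟩)).comp π₁).toLinearMap_mem_endAlg)
      (((ι₂.comp (endAlg.toHom ⟨A₂.ι a, fun p => A₂.map_F_le a p⟩)).comp π₂).toLinearMap_mem_endAlg)
  let Ad : EndAction (BettiUniverse.hodge exists_isReal_hodgeModel_holds hP 1) (EndField E hFE) :=
    { ι := AlgHom.ofLinearMap L hL1 hLmul, map_F_le := fun a p => hLmem a p }
  have hAι : ∀ a, Ad.ι a = L a := fun a => rfl
  have hA₁ : ∀ a, Ad.ι a ∘ₗ ι₁.toLinearMap = ι₁.toLinearMap ∘ₗ A₁.ι a := fun a => by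
    rw [hAι, hL]
    refine LinearMap.ext fun v => ?_
    simp only [LinearMap.add_apply, LinearMap.comp_apply, hπι₁, h21, map_zero, add_zero]
  have hA₂ : ∀ a, Ad.ι a ∘ₗ ι₂.toLinearMap = ι₂.toLinearMap ∘ₗ A₂.ι a := fun a => by
    rw [hAι, hL]
    refine LinearMap.ext fun v => ?_
    simp only [LinearMap.add_apply, LinearMap.comp_apply, hπι₂, h12, map_zero, zero_add]
  -- Weil type: `2 (n_σ(A) + (m+1) n_σ(E)) = (2g + 2(g−2)) / 2`
  have hsumA := eigenMultiplicity_add_eigenMultiplicity_neg_eq_dim A φ hD hφ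
  have hsumE := eigenMultiplicity_add_eigenMultiplicity_neg_eq_dim E χ hD hχ
  rw [hE1] at hsumE
  rw [hdim] at hsumA
  have hpow := eigenMultiplicity_powSuccMap χ (Complex.I * (Real.sqrt D : ℂ)) m
  have hpow' := eigenMultiplicity_powSuccMap χ (-(Complex.I * (Real.sqrt D : ℂ))) m
  have hV : Module.finrank ℚ (bettiCohomology (A.prod (E.powSucc m)).X 1) = 2 * (2 * m + 4) := by
    rw [finrank_bettiCohomology_one, dim_prod, hBdim, hdim]; ring
  have h01 : eigenMultiplicity E χ (Complex.I * (Real.sqrt D : ℂ)) = 0 ∨ eigenMultiplicity E χ (Complex.I * (Real.sqrt D : ℂ)) = 1 := by omega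
  have hW : ∀ σ : EndField E hFE →+* ℂ, 2 * (A₁.multiplicity σ + A₂.multiplicity σ) =
      Module.finrank ℚ (bettiCohomology (A.prod (E.powSucc m)).X 1) / 2 := by
    intro σ
    rw [hV, Nat.mul_div_cancel_left _ two_pos, multiplicity_hOneEndAction_eq_eigenMultiplicity ρA hK2 hD hcK φ hρAc σ,
      multiplicity_hOneEndAction_eq_eigenMultiplicity ρB hK2 hD hcK (powSuccMap χ m) hρBc σ]
    rcases apply_eq_or_eq_neg_of_sq_eq_neg hcK σ with h | h
    · rw [h, hpow]
      rcases h01 with h0 | h0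
      · rw [h0, mul_zero] at hmult ⊢; omega
      · rw [h0, mul_one] at hmult ⊢; omega
    · rw [h, hpow']
      rcases h01 with h0 | h0
      · have hE' : eigenMultiplicity E χ (-(Complex.I * (Real.sqrt D : ℂ))) = 1 := by omega
        rw [h0, mul_zero] at hmult
        rw [hE', mul_one]
        omega
      · have hE' : eigenMultiplicity E χ (-(Complex.I * (Real.sqrt D : ℂ))) = 0 := by omega
        rw [h0, mul_one] at hmult
        rw [hE', mul_zero]
        omega
  have hV₂ : 2 ≤ Module.finrank ℚ (bettiCohomology (E.powSucc m).X 1) := by rw [finrank_bettiCohomology_one, hBdim]; omega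
  have heff := BettiUniverse.hodge_isEffective exists_isReal_hodgeModel_holds hP 1
  -- `(χ^{g−2})^* ∈ Lie Hg(H¹(E^{g−2}))`
  have hmem : A₂.ι c ∈ (BettiUniverse.hodge exists_isReal_hodgeModel_holds hB 1).hodgeLie := by
    have hA₂c : A₂.ι c = (bettiCohomology.map (powSuccMap χ m).hom.hom.hom 1).hom := by
      change hOneAlgHom ρB c = _
      rw [hOneAlgHom_apply, hρBc, bettiRep_of, MulOpposite.unop_op]
    rw [hA₂c]
    exact pull_powSuccMap_mem_hodgeLie χ (bettiMap_mem_hodgeLie_of_cmCurve hE hE1 χ hD hχ) m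
  have hlt := (corner_not_mem_and_finrank_hodgeLie_lt_of_weilType_of_two_le ι₁ π₁ ι₂ π₂ hπι₁ hπι₂ hsum A₁ A₂ Ad hA₁ hA₂ heff hK2 hV₂
    hW hc0).2 hmem
  -- `dim Lie Hg(H¹(E^{g−2})) = dim Lie Hg(H¹E) = 1`
  have h1E : Module.finrank ℚ (BettiUniverse.hodge exists_isReal_hodgeModel_holds hE 1).hodgeLie = 1 := by
    have h := mtRank_hodge_one_eq_finrank_hodgeLie_add_one hE (by omega)
    omega
  have h1B : Module.finrank ℚ (BettiUniverse.hodge exists_isReal_hodgeModel_holds hB 1).hodgeLie = 1 := by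
    rw [finrank_hodgeLie_hodge_one_powSucc_eq hB hE (by omega), h1E]
  rw [hgg, h1B] at hlt
  rw [hgg] at hge
  omega

/-! ## §2 `t(A × E) = g² + 1` -/

/-- **`t(X) = g² + 1` for `X ∼ E × A`, `A` of Ribet type `(g−1,1)`, `E` a CM elliptic curve with the SAME field, roots matched** (`χ ∘ χ = −D = φ ∘ φ`,
`n_{i√D}(A) + (g−2)·n_{i√D}(E) = g − 1`, `dim A = m + 3 = g`): §1 on `A × E^{g−2}` and `t(A × E) = t(A × E^{g−2})`
(`mtRank_hodge_one_eq_of_isIsogenous_prod_powSucc`).  Versus `g² + 2` for different fields.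
[cite: MoonenZarhin1999LowDim, Thm. 0.1 (4) and §3 (3.1)] [cite: Ribet1983, Thm. 3] -/
theorem mtRank_hodge_one_eq_of_isIsogenous_ribetTypeOne_prod_cmCurve_sameField (hX : IsSmoothProjective n X.X) {m : ℕ}
    (hF : IsField A.endAlgebra) (hnR : ¬ IsTotallyReal (EndField A hF)) (φ : A ⟶ A) {D : ℕ} (hD : 0 < D) (hφ : φ ≫ φ = -(D • 𝟙 A))
    (hA2 : Module.finrank ℚ A.endAlgebra = 2)
    (h1 : eigenMultiplicity A φ (Complex.I * (Real.sqrt D : ℂ)) = 1 ∨ eigenMultiplicity A φ (-(Complex.I * (Real.sqrt D : ℂ))) = 1)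
    (hdim : A.dim = m + 3) (hE1 : E.dim = 1) (χ : E ⟶ E) (hχ : χ ≫ χ = -(D • 𝟙 E))
    (hmult : eigenMultiplicity A φ (Complex.I * (Real.sqrt D : ℂ)) + (m + 1) * eigenMultiplicity E χ (Complex.I * (Real.sqrt D : ℂ)) = m + 2)
    (hXP : IsIsogenous X (E.prod A)) :
    haveI := BettiUniverse.finite hX 1
    (BettiUniverse.hodge exists_isReal_hodgeModel_holds hX 1).mtRank = A.dim * A.dim + 1 := by
  haveI := BettiUniverse.finite hX 1
  have hP : IsSmoothProjective (A.prod (E.powSucc m)).dim (A.prod (E.powSucc m)).X := AbelianVariety.isSmoothProjective_holds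
  haveI := BettiUniverse.finite hP 1
  have h0 : 0 < (A.prod E).dim := by rw [dim_prod]; omega
  have hP0 : 0 < (A.prod (E.powSucc m)).dim := by rw [dim_prod]; omega
  -- `t(A × E^{g−2}) = t(X)`
  have heq := mtRank_hodge_one_eq_of_isIsogenous_prod_powSucc hP hX h0 m (IsIsogenous.refl _) (hXP.trans (isIsogenous_prod_comm E A))
  rw [← heq, mtRank_hodge_one_eq_finrank_hodgeLie_add_one hP hP0,
    finrank_hodgeLie_hodge_one_ribetTypeOne_prod_cmCurvePow_sameField hP hF hnR φ hD hφ hA2 h1 hdim hE1 χ hχ hmult]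

/-- **`t(X) = g² + 1` for `X ∼ E × A`, `A` of Ribet type `(g−1,1)` with `φ ∘ φ = −D`, and `E` an elliptic curve admitting SOME `χ` with `χ ∘ χ = −D`**
(the same imaginary quadratic field `ℚ(√−D)`; the sign of `χ` is fixed inside: both `± χ` qualify and exactly one matches the roots, since
`n_{i√D}(A) ∈ {1, g−1}` and `n_{i√D}(±χ)` are `0` and `1`).  `Hg(A × E)` has codimension ONE in `Hg(A) × Hg(E)` for every `g ≥ 3`.
[cite: MoonenZarhin1999LowDim, Thm. 0.1 (4) and Prop. (3.8)] [cite: Ribet1983, Thm. 3] -/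
theorem mtRank_hodge_one_eq_of_isIsogenous_ribetTypeOne_prod_cmCurve_of_exists_comp_self_eq_neg (hX : IsSmoothProjective n X.X)
    (hF : IsField A.endAlgebra) (hnR : ¬ IsTotallyReal (EndField A hF)) (φ : A ⟶ A) {D : ℕ} (hD : 0 < D) (hφ : φ ≫ φ = -(D • 𝟙 A))
    (hA2 : Module.finrank ℚ A.endAlgebra = 2)
    (h1 : eigenMultiplicity A φ (Complex.I * (Real.sqrt D : ℂ)) = 1 ∨ eigenMultiplicity A φ (-(Complex.I * (Real.sqrt D : ℂ))) = 1)
    (hdim : 3 ≤ A.dim) (hE1 : E.dim = 1) (hEχ : ∃ χ : E ⟶ E, χ ≫ χ = -(D • 𝟙 E)) (hXP : IsIsogenous X (E.prod A)) :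
    haveI := BettiUniverse.finite hX 1
    (BettiUniverse.hodge exists_isReal_hodgeModel_holds hX 1).mtRank = A.dim * A.dim + 1 := by
  obtain ⟨χ, hχ⟩ := hEχ
  obtain ⟨m, hm⟩ : ∃ m, A.dim = m + 3 := ⟨A.dim - 3, by omega⟩
  have hsumA := eigenMultiplicity_add_eigenMultiplicity_neg_eq_dim A φ hD hφ
  have hsumE := eigenMultiplicity_add_eigenMultiplicity_neg_eq_dim E χ hD hχ
  rw [hE1] at hsumE
  rw [hm] at hsumA
  have h01 : eigenMultiplicity E χ (Complex.I * (Real.sqrt D : ℂ)) = 0 ∨ eigenMultiplicity E χ (Complex.I * (Real.sqrt D : ℂ)) = 1 := by omega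
  -- match the roots: use `χ` or `−χ`
  by_cases hmatch : eigenMultiplicity A φ (Complex.I * (Real.sqrt D : ℂ)) + (m + 1) * eigenMultiplicity E χ (Complex.I * (Real.sqrt D : ℂ)) = m + 2
  · exact mtRank_hodge_one_eq_of_isIsogenous_ribetTypeOne_prod_cmCurve_sameField hX hF hnR φ hD hφ hA2 h1 hm hE1 χ hχ hmatch hXP
  · have hχ' : (-χ) ≫ (-χ) = -(D • 𝟙 E) := by rw [Preadditive.neg_comp, Preadditive.comp_neg, neg_neg, hχ]
    refine mtRank_hodge_one_eq_of_isIsogenous_ribetTypeOne_prod_cmCurve_sameField hX hF hnR φ hD hφ hA2 h1 hm hE1 (-χ) hχ' ?_ hXP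
    rw [eigenMultiplicity_neg₃]
    rcases h01 with h0 | h0
    · have hE' : eigenMultiplicity E χ (-(Complex.I * (Real.sqrt D : ℂ))) = 1 := by omega
      rw [h0, mul_zero] at hmatch
      rw [hE', mul_one]
      omega
    · have hE' : eigenMultiplicity E χ (-(Complex.I * (Real.sqrt D : ℂ))) = 0 := by omega
      rw [h0, mul_one] at hmatch
      rw [hE', mul_zero]
      omega

end Summit.HodgeConjecture.CorCM

end
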